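import Summits.FinalStateConjecture.FinalStateConjecture.Theorems.SwallowTheDatumKerrShieldedSettlesStubKerrLeafSojournAux2
import Summits.FinalStateConjecture.FinalStateConjecture.Theorems.SwallowTheDatumKerrShieldedSettlesStubScriTransportAux
import HarnessLib

/-!
# Crux `PhaseMixingCapture.CaptureSufficesC2` (stmt-FinalStateConjecture-14986), line `Sketch`,
# stub `stub_softShieldedScri` — support file 5: the causal future in the Kerr–Schild chart lies
# inside the Minkowski cone

Clauses (P2) (acausality of the leaf) and (P4) (the pre-segment of a ray avoids `J⁺` of a compact
leaf piece) of the LEAF PACKAGE of `stub_softShieldedScri` (module docstring of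
`…StubSoftShieldedScriAssembly.lean`), as well as the construction of the exact Kerr sandwich region
as the domain of dependence of the far bent slice (the piece-domain of
`Literature/…/CauchyPieceDomain.lean` inside the tapered collar), all consume ONE coordinate fact
about the ingoing Kerr–Schild chart `(Kerr.region a r₁, g_{M,a})`, `M ≥ 0`: **the causal future of a
chart point lies inside its Minkowski cone, and coordinate time increases along it** —
`q ∈ J⁺(p) ⟹ ‖q⃗ − p⃗‖ ≤ q⁰ − p⁰` (`stub_softShieldedScri_chartCone`).  Proof: along a future causal
curve the chart velocity `v` has `g(v, v) ≤ 0` and `g(V, v) = −v⁰ < 0`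
(`ScriTransport.causalCurve_velocity`, `Kerr.bilin_timeVector`), hence `|v⃗| ≤ v⁰`
(`KerrLeafSojourn.norm_spatial_le_of_causal`: the light cones of `g = η + 2Hℓ ⊗ ℓ`, `H ≥ 0`, lie
inside those of `η`), and the integrated light-cone bound
`KerrLeafSojourn.norm_spatial_sub_le_time_sub` applies.  Kerr–Schild 1965, §2; O'Neill 1983, Ch. 14,
pp. 402, 415.
-/

set_option linter.dupNamespace false

noncomputable section

open Set Filter
open scoped Manifold ContDiff Topology
open Literature.Geometry.Lorentzian
open Summit.FinalStateConjecture.FinalStateConjecture.Theorems.SwallowTheDatum.KerrShieldedSettles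
  (ScriTransport.causalCurve_velocity)
open Summit.FinalStateConjecture.FinalStateConjecture.Theorems.SwallowTheDatum.KerrShieldedSettles.KerrLeafSojourn
  (norm_spatial_le_of_causal norm_spatial_sub_le_time_sub)

namespace Summit.FinalStateConjecture.FinalStateConjecture.Theorems.CaptureSufficesC2.Sketch

namespace SoftShieldedScri

/-- **Along a future causal curve of the Kerr–Schild chart the spatial displacement is bounded by the
elapsed coordinate time**: `‖γ⃗(σ₂) − γ⃗(σ₁)‖ ≤ x⁰(γ σ₂) − x⁰(γ σ₁)` for `σ₁ ≤ σ₂` in the (order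
connected) parameter set (`M ≥ 0`; `|v⃗| ≤ v⁰` pointwise, then the integrated light-cone bound).
O'Neill 1983, Ch. 14, p. 415. [cite: ONeillSemiRiemannian1983, Ch. 14, Def. 14.28 (p. 415)] -/
theorem norm_spatial_sub_le_of_isFutureCausalCurveOn [Kerr.Facts] {M a r₁ : ℝ} (hM : 0 ≤ M)
    {γ : ℝ → Kerr.region a r₁} {s : Set ℝ} (hs : s.OrdConnected)
    (hγ : (Kerr.smoothMetric M a r₁).IsFutureCausalCurveOn
      ((Kerr.timeOrientation M a r₁ hM).ofLE le_top) γ s)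
    {σ₁ σ₂ : ℝ} (h₁ : σ₁ ∈ s) (h₂ : σ₂ ∈ s) (h12 : σ₁ ≤ σ₂) :
    ‖E4.spatial (γ σ₂ : E4) - E4.spatial (γ σ₁ : E4)‖ ≤ (γ σ₂ : E4) 0 - (γ σ₁ : E4) 0 := by
  refine norm_spatial_sub_le_time_sub hs (fun t ht ↦ (ScriTransport.causalCurve_velocity hγ ht).1)
    (fun t ht ↦ ?_) h₁ h₂ h12
  obtain ⟨-, hc, -, hfd⟩ := ScriTransport.causalCurve_velocity hγ ht
  have hx : 0 < Kerr.radius a (γ t : E4) := Kerr.radius_pos_of_mem_region (γ t).2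
  rw [Kerr.bilin_timeVector hx] at hfd
  exact norm_spatial_le_of_causal hM a _ hc (by linarith)

/-- **Registered sub-goal `stub_softShieldedScri_chartCone` of stub `stub_softShieldedScri`** (line
`Sketch`, crux stmt-FinalStateConjecture-14986): **in the ingoing Kerr–Schild chart `J⁺` of a point
lies inside its Minkowski cone** — for `M ≥ 0` and chart points `p`, `q` of `Kerr.region a r₁` with
`q ∈ J⁺(p)` (for `g_{M,a}` and its time orientation), `‖q⃗ − p⃗‖ ≤ q⁰ − p⁰`; in particular
`p⁰ ≤ q⁰`.  Kerr–Schild 1965, §2 (the light cones of `g` lie inside those of `η`); O'Neill 1983,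
Ch. 14, pp. 402, 415. [cite: KerrSchild1965, §2] -/
theorem stub_softShieldedScri_chartCone : ∀ [Kerr.Facts] (M a r₁ : ℝ) (hM : 0 ≤ M) (p q : Kerr.region a r₁), q ∈ (Kerr.smoothMetric M a r₁).causalFuture ((Kerr.timeOrientation M a r₁ hM).ofLE le_top) {p} → ‖E4.spatial (q : E4) - E4.spatial (p : E4)‖ ≤ (q : E4) 0 - (p : E4) 0 :=
  fun M a r₁ hM p q hq ↦ by
    rcases hq with hqp | ⟨p', hp', γ, t₁, t₂, ht, hγ, hγ₁, hγ₂⟩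
    · rw [show q = p from hqp, sub_self, sub_self, norm_zero]
    · rw [show p' = p from hp'] at hγ₁
      rw [← hγ₁, ← hγ₂]
      exact norm_spatial_sub_le_of_isFutureCausalCurveOn hM ordConnected_Icc hγ
        (left_mem_Icc.2 ht.le) (right_mem_Icc.2 ht.le) ht.le

end SoftShieldedScri

end Summit.FinalStateConjecture.FinalStateConjecture.Theorems.CaptureSufficesC2.Sketch

end
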